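import Literature.Probability.Percolation.SahiThreePointSeparation
import HarnessLib

/-!
# `NoHeavyLowerTail` (stmt-CriticalPhenomena-4575) — three-point row links: the direct-channel covariance
# identity, Gladkov–Zimin's Remark 6.4, and `G3 ⟹ Sahi E₃` on the pairwise-separation triple

Support file (prover prim-ineq-gen-4, new-inequality factory; `--supports stmt-CriticalPhenomena-4575`).
No definitions, no named facts, no sorries.

Setting: Bernoulli bond percolation `μ = prodBernoulli w` on a finite vertex type, three vertices
`a, b, c`, the five cells of their connection pattern
`t = μ(abc)`, `u₃ = μ(ab|c)`, `u₂ = μ(ac|b)`, `u₁ = μ(a|bc)`, `q = μ(a|b|c)`,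
`e₂ = u₃u₂ + u₃u₁ + u₂u₁`, `e₃ = u₃u₂u₁` (as in `Literature.Probability.Percolation.SahiThreePointSeparation`).

* `cov_openConn_eq_agExcess_add` — the EXACT identity behind the factory row `gen5-DCC2`
  (`Cov(1{a↔b},1{a↔c})² ≤ (4/27)·μ(a|bc)`, the sharp form of [GladkovZimin2024, Conj. 6.3]):
  `μ(ab ∩ ac) − μ(ab)μ(ac) = (q·t − e₂) + u₁·(1 − u₁ − q)`,
  i.e. the covariance of the two connections through `a` is the Aas–Gladkov excess plus
  `μ(a|bc)·μ(ab ∪ ac)`.  Hence DCC2 ⟺ `q t − e₂ ≤ √((4/27)u₁) − u₁(1 − u₁ − q)` and Conj. 6.3 ⟺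
  "the Aas–Gladkov inequality is asymptotically tight as `μ(a|bc) → 0`" (memo
  run/shared/lean/prim/prim-ineq-gen-4/NOTE-DCC2-STRUCTURE-g3.md).
* `gladkovZimin2024_remark_6_4` — [GladkovZimin2024, Remark 6.4] (relabelled, `a` the middle vertex):
  `μ(a|bc)·μ(ab ∪ ac) ≤ μ(ab ∩ ac) − μ(ab)μ(ac)`, PROVED from the identity and the Aas–Gladkov
  inequality `prodBernoulli_threePoint_strongHarris` ("Harris with a floor").
* `sahiE3_pairSep_nonneg_of_G3` — the census-validated factory row `G3`/`AG⁺` of prim-lit-2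
  (`q t − e₂ ≥ e₃`, harness `lit2-SF3-G3`, `gen4g3-G3g`; 0 violations in ≈ 7·10⁷ exact evaluations,
  NOT proved) implies Sahi's `E₃ ≥ 0` on the pairwise-separation triple (an instance of
  [Kahn2022, Conjecture 5]) with slack `t·e₃`: a typed link, hypothesis stated inline as an inequality.

References: N. Gladkov, A. Zimin, *Bond percolation does not simulate site percolation*,
arXiv:2404.08873 = ECP (2026), §6 Remark 6.4, Conj. 6.3 [GladkovZimin2024];
N. Gladkov, BLMS 56 (2024) Cor. 4.2 [Gladkov2024StrongFKG]; J. Kahn, arXiv:2210.08653, Conj. 5 [Kahn2022].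
-/

noncomputable section

namespace Summit.CriticalPhenomena.PercolationContinuityZ3.Theorems

open MeasureTheory Literature.Probability.LatticeModels Literature.Probability.Percolation

variable {V : Type*} [Finite V]

omit [Finite V] in
/-- `{a↔b} ∩ {b↔c} = {a↔b} ∩ {a↔c}` (transitivity of open connection). [folklore] -/
private theorem openConn_inter_bc_eq' (a b c : V) :
    (openConn a b ∩ openConn b c : Set (BondConfig V)) = openConn a b ∩ openConn a c := by
  ext ω
  constructor
  · rintro ⟨hab, hbc⟩
    exact ⟨hab, SimpleGraph.Reachable.trans hab hbc⟩
  · rintro ⟨hab, hac⟩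
    exact ⟨hab, SimpleGraph.Reachable.trans (SimpleGraph.Reachable.symm hab) hac⟩

omit [Finite V] in
/-- `{a↔c} ∩ {b↔c} = {a↔b} ∩ {a↔c}` (transitivity of open connection). [folklore] -/
private theorem openConn_inter_ac_bc_eq' (a b c : V) :
    (openConn a c ∩ openConn b c : Set (BondConfig V)) = openConn a b ∩ openConn a c := by
  ext ω
  constructor
  · rintro ⟨hac, hbc⟩
    exact ⟨SimpleGraph.Reachable.trans hac (SimpleGraph.Reachable.symm hbc), hac⟩
  · rintro ⟨hab, hac⟩
    exact ⟨hac, SimpleGraph.Reachable.trans (SimpleGraph.Reachable.symm hab) hac⟩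

/-- **Direct-channel covariance identity.**  For `μ = prodBernoulli w` and vertices `a, b, c`:
`μ(ab ∩ ac) − μ(ab)·μ(ac) = (μ(a|b|c)·μ(abc) − e₂) + μ(a|bc)·(1 − μ(a|bc) − μ(a|b|c))`, where
`e₂ = μ(ab|c)μ(ac|b) + μ(ab|c)μ(a|bc) + μ(ac|b)μ(a|bc)`: the covariance of the two connection events
through `a` equals the Aas–Gladkov excess plus `μ(a|bc)·μ(ab ∪ ac)`.  (Pure bookkeeping on the five
cells; not in the sources — it is the reformulation of the factory row DCC2 / [GladkovZimin2024,
Conj. 6.3] used in run/shared/lean/prim/prim-ineq-gen-4/NOTE-DCC2-STRUCTURE-g3.md.) -/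
theorem cov_openConn_eq_agExcess_add (w : Sym2 V → unitInterval) (a b c : V) :
    (prodBernoulli w).real (openConn a b ∩ openConn a c) -
        (prodBernoulli w).real (openConn a b) * (prodBernoulli w).real (openConn a c) =
      ((prodBernoulli w).real ((openConn a b)ᶜ ∩ (openConn a c)ᶜ ∩ (openConn b c)ᶜ) *
            (prodBernoulli w).real (openConn a b ∩ openConn a c) -
          ((prodBernoulli w).real (openConn a b ∩ (openConn a c)ᶜ) *
              (prodBernoulli w).real (openConn a c ∩ (openConn a b)ᶜ) +
            (prodBernoulli w).real (openConn a b ∩ (openConn a c)ᶜ) *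
              (prodBernoulli w).real (openConn b c ∩ (openConn a b)ᶜ) +
            (prodBernoulli w).real (openConn a c ∩ (openConn a b)ᶜ) *
              (prodBernoulli w).real (openConn b c ∩ (openConn a b)ᶜ))) +
        (prodBernoulli w).real (openConn b c ∩ (openConn a b)ᶜ) *
          (1 - (prodBernoulli w).real (openConn b c ∩ (openConn a b)ᶜ) -
            (prodBernoulli w).real ((openConn a b)ᶜ ∩ (openConn a c)ᶜ ∩ (openConn b c)ᶜ)) := by
  classical
  set μ := prodBernoulli w with hμ
  set Eab : Set (BondConfig V) := openConn a b with hEab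
  set Eac : Set (BondConfig V) := openConn a c with hEac
  set Ebc : Set (BondConfig V) := openConn b c with hEbc
  have mEab : MeasurableSet Eab := MeasurableSet.of_discrete
  have mEac : MeasurableSet Eac := MeasurableSet.of_discrete
  have mEbc : MeasurableSet Ebc := MeasurableSet.of_discrete
  set T : Set (BondConfig V) := Eab ∩ Eac with hT
  have hT₁ : Eab ∩ Ebc = T := openConn_inter_bc_eq' a b c
  have hT₂ : Eac ∩ Ebc = T := openConn_inter_ac_bc_eq' a b c
  set x := μ.real Eab with hx
  set y := μ.real Eac with hy
  set z := μ.real Ebc with hz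
  set t := μ.real T with ht
  have hU3 : μ.real (Eab ∪ Eac ∪ Ebc) = x + y + z - 2 * t := by
    have hU : μ.real (Eab ∪ Eac) = x + y - t := by
      have h := measureReal_union_add_inter (μ := μ) (s := Eab) mEac
      linarith
    have h := measureReal_union_add_inter (μ := μ) (s := Eab ∪ Eac) mEbc
    have hI : (Eab ∪ Eac) ∩ Ebc = T := by
      rw [Set.union_inter_distrib_right, hT₁, hT₂, Set.union_self]
    rw [hI] at h
    linarith
  have cQ : μ.real (Eabᶜ ∩ Eacᶜ ∩ Ebcᶜ) = 1 - x - y - z + 2 * t := by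
    rw [← Set.compl_union, ← Set.compl_union,
      probReal_compl_eq_one_sub ((mEab.union mEac).union mEbc), hU3]
    ring
  have u₃ : μ.real (Eab ∩ Eacᶜ) = x - t := by
    have h := measureReal_inter_add_sdiff (μ := μ) (s := Eab) mEac
    rw [Set.sdiff_eq] at h
    linarith
  have u₂ : μ.real (Eac ∩ Eabᶜ) = y - t := by
    have h := measureReal_inter_add_sdiff (μ := μ) (s := Eac) mEab
    rw [Set.sdiff_eq, Set.inter_comm Eac Eab] at h
    linarith
  have u₁ : μ.real (Ebc ∩ Eabᶜ) = z - t := by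
    have h := measureReal_inter_add_sdiff (μ := μ) (s := Ebc) mEab
    rw [Set.sdiff_eq, Set.inter_comm Ebc Eab, hT₁] at h
    linarith
  rw [cQ, u₃, u₂, u₁]
  ring

/-- **[GladkovZimin2024, Remark 6.4] for `prodBernoulli w` (relabelled so that `a` is the middle
vertex): "if `(abc) − (ac)(bc) < ε` then `(ab|c) < ε/(ac ∪ bc)`", i.e. in covariance form
`μ(a|bc)·μ(ab ∪ ac) ≤ μ(ab ∩ ac) − μ(ab)·μ(ac)`, where `μ(ab ∪ ac) = 1 − μ(a|bc) − μ(a|b|c)`.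
PROVED from `cov_openConn_eq_agExcess_add` and the Aas–Gladkov inequality
`prodBernoulli_threePoint_strongHarris` ("Harris with a floor": the direct channel `a|bc` forces a
positive covariance). [cite: GladkovZimin2024, Remark 6.4 (arXiv §6); Gladkov2024StrongFKG, Cor. 4.2] -/
theorem gladkovZimin2024_remark_6_4 (w : Sym2 V → unitInterval) (a b c : V) :
    (prodBernoulli w).real (openConn b c ∩ (openConn a b)ᶜ) *
        (1 - (prodBernoulli w).real (openConn b c ∩ (openConn a b)ᶜ) -
          (prodBernoulli w).real ((openConn a b)ᶜ ∩ (openConn a c)ᶜ ∩ (openConn b c)ᶜ)) ≤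
      (prodBernoulli w).real (openConn a b ∩ openConn a c) -
        (prodBernoulli w).real (openConn a b) * (prodBernoulli w).real (openConn a c) := by
  rw [cov_openConn_eq_agExcess_add]
  have hAG := prodBernoulli_threePoint_strongHarris w a b c
  linarith

/-- **`G3 ⟹ Sahi E₃` on the pairwise-separation triple.**  If the (census-validated, UNPROVED)
factory row `G3`/`AG⁺` of prim-lit-2 — the Aas–Gladkov inequality with the cubic term,
`μ(a|b|c)μ(abc) − e₂ ≥ e₃` (harness `lit2-SF3-G3`, glued copies `gen4g3-G3g`) — holds for the three
vertices `a, b, c` of `prodBernoulli w`, then Sahi's third-order functional of the three decreasing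
events `{a↮b}, {a↮c}, {b↮c}` is at least `μ(abc)·e₃ ≥ 0`, an instance of [Kahn2022, Conjecture 5].
The hypothesis is an explicit inequality (no named fact); the proof is `prodBernoulli_sahiE3_pairSep_eq`
plus arithmetic. [cite: LiebSahi2021, eq. (2.1); Kahn2022, Conjecture 5 (arXiv p. 3)] -/
theorem sahiE3_pairSep_nonneg_of_G3 (w : Sym2 V → unitInterval) (a b c : V)
    (hG3 : (prodBernoulli w).real (openConn a b ∩ (openConn a c)ᶜ) *
          (prodBernoulli w).real (openConn a c ∩ (openConn a b)ᶜ) *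
          (prodBernoulli w).real (openConn b c ∩ (openConn a b)ᶜ) ≤
        (prodBernoulli w).real ((openConn a b)ᶜ ∩ (openConn a c)ᶜ ∩ (openConn b c)ᶜ) *
            (prodBernoulli w).real (openConn a b ∩ openConn a c) -
          ((prodBernoulli w).real (openConn a b ∩ (openConn a c)ᶜ) *
              (prodBernoulli w).real (openConn a c ∩ (openConn a b)ᶜ) +
            (prodBernoulli w).real (openConn a b ∩ (openConn a c)ᶜ) *
              (prodBernoulli w).real (openConn b c ∩ (openConn a b)ᶜ) +
            (prodBernoulli w).real (openConn a c ∩ (openConn a b)ᶜ) *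
              (prodBernoulli w).real (openConn b c ∩ (openConn a b)ᶜ))) :
    (prodBernoulli w).real (openConn a b ∩ openConn a c) *
        ((prodBernoulli w).real (openConn a b ∩ (openConn a c)ᶜ) *
          (prodBernoulli w).real (openConn a c ∩ (openConn a b)ᶜ) *
          (prodBernoulli w).real (openConn b c ∩ (openConn a b)ᶜ)) ≤
      sahiE3 (prodBernoulli w) (openConn a b)ᶜ (openConn a c)ᶜ (openConn b c)ᶜ := by
  rw [prodBernoulli_sahiE3_pairSep_eq]
  set t := (prodBernoulli w).real (openConn a b ∩ openConn a c) with ht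
  set e₃ := (prodBernoulli w).real (openConn a b ∩ (openConn a c)ᶜ) *
      (prodBernoulli w).real (openConn a c ∩ (openConn a b)ᶜ) *
      (prodBernoulli w).real (openConn b c ∩ (openConn a b)ᶜ) with he₃
  set A := (prodBernoulli w).real ((openConn a b)ᶜ ∩ (openConn a c)ᶜ ∩ (openConn b c)ᶜ) *
        (prodBernoulli w).real (openConn a b ∩ openConn a c) -
      ((prodBernoulli w).real (openConn a b ∩ (openConn a c)ᶜ) *
          (prodBernoulli w).real (openConn a c ∩ (openConn a b)ᶜ) +
        (prodBernoulli w).real (openConn a b ∩ (openConn a c)ᶜ) *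
          (prodBernoulli w).real (openConn b c ∩ (openConn a b)ᶜ) +
        (prodBernoulli w).real (openConn a c ∩ (openConn a b)ᶜ) *
          (prodBernoulli w).real (openConn b c ∩ (openConn a b)ᶜ)) with hA
  have ht0 : 0 ≤ t := measureReal_nonneg
  have h1 : t * e₃ ≤ t * A := mul_le_mul_of_nonneg_left hG3 ht0
  linarith

/-- **`G3 ⟹ E₃ ≥ 0`** (the bare instance of [Kahn2022, Conjecture 5] on the pairwise-separation triple,
from the row hypothesis of `sahiE3_pairSep_nonneg_of_G3`). [cite: Kahn2022, Conjecture 5 (arXiv p. 3)] -/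
theorem sahiE3_pairSep_nonneg_of_G3' (w : Sym2 V → unitInterval) (a b c : V)
    (hG3 : (prodBernoulli w).real (openConn a b ∩ (openConn a c)ᶜ) *
          (prodBernoulli w).real (openConn a c ∩ (openConn a b)ᶜ) *
          (prodBernoulli w).real (openConn b c ∩ (openConn a b)ᶜ) ≤
        (prodBernoulli w).real ((openConn a b)ᶜ ∩ (openConn a c)ᶜ ∩ (openConn b c)ᶜ) *
            (prodBernoulli w).real (openConn a b ∩ openConn a c) -
          ((prodBernoulli w).real (openConn a b ∩ (openConn a c)ᶜ) *
              (prodBernoulli w).real (openConn a c ∩ (openConn a b)ᶜ) +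
            (prodBernoulli w).real (openConn a b ∩ (openConn a c)ᶜ) *
              (prodBernoulli w).real (openConn b c ∩ (openConn a b)ᶜ) +
            (prodBernoulli w).real (openConn a c ∩ (openConn a b)ᶜ) *
              (prodBernoulli w).real (openConn b c ∩ (openConn a b)ᶜ))) :
    0 ≤ sahiE3 (prodBernoulli w) (openConn a b)ᶜ (openConn a c)ᶜ (openConn b c)ᶜ := by
  have h := sahiE3_pairSep_nonneg_of_G3 w a b c hG3
  have h0 : 0 ≤ (prodBernoulli w).real (openConn a b ∩ openConn a c) *
      ((prodBernoulli w).real (openConn a b ∩ (openConn a c)ᶜ) *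
        (prodBernoulli w).real (openConn a c ∩ (openConn a b)ᶜ) *
        (prodBernoulli w).real (openConn b c ∩ (openConn a b)ᶜ)) :=
    mul_nonneg measureReal_nonneg
      (mul_nonneg (mul_nonneg measureReal_nonneg measureReal_nonneg) measureReal_nonneg)
  linarith

end Summit.CriticalPhenomena.PercolationContinuityZ3.Theorems
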